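import Literature.Probability.Percolation.SlabCircuitUniqBound
import HarnessLib

/-!
# Newman–Tassion–Wu 2017, Theorem 3.10 — the chain of the four corner gluings: from the side
# crossings with unique hub clusters to a surrounding open circuit, modulo the corner-gluing
# inequalities

Topic: `Literature/Probability/Percolation`. Eighth file of the port of THEOREM 3.10 of
Newman–Tassion–Wu, *Critical percolation and the minimal spanning tree in slabs* (CPAM 70 (2017);
arXiv:1512.09107, pp. 13–14): "We claim that there exists a constant `c₃ > 0` such that
`P[𝒜_{λn,λn+n}] ≥ c₃² P[ℰ]` … we now perform a two step gluing procedure in the square regions `R₁`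
and `R₂` … We first prove `P[Γ₁ ⟷^{S₂'} L(S₂'), ℰ] ≥ c₃ P[ℰ]` and then
`P[𝒜_{λn,λn+n}] ≥ c₃ P[Γ₁ ⟷^{S₂'} L(S₂'), ℰ]`."  The port glues FOUR corners (minimal paths in
rectangles, `SlabCircuitFromCornerLinks.lean`); each gluing is consumed through the corner-gluing
inequality `CornerGlueᵢ k N n p K` (`SlabCircuitSideCrossings.lean`) applied with a BYSTANDER
event carrying everything already established — the earlier corner links, the uniqueness of the
hub clusters, and the parts of the side crossings that the later corners need — all of which are
determined by edges off the current corner square.  Result: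

* `byst₁ … byst₄`, `stage₁ … stage₄` — the bystander events and the stages
  `stageᵢ = cornerLinkᵢ ∩ bystᵢ` of the chain; `stage_mono` lemmas (each stage, off the next
  corner link, lies in the next corner's domain event with its bystander).
* **`NTW17.real_circuitAround_ge_of_cornerGlue`** — for `N ≥ 2`: if `CornerGlue₁..₄ k N n p K` hold
  (`K ≥ 0`) and `P[hubCross_X]² ≤ δ P[sideCross_X]` for the four sides (`0 ≤ δ`, `4δ ≤ 1/2`), then
  `½ · Π_X P[sideCross_X] ≤ (1+K)⁴ · P[circuitAround k 0 N (N+n+1)]`.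

With the smallness of the hub crossings (many disjoint hard boxes), the linear extension bound
`P[sideCross] ≥ c₁² P[hubCross]` and Prop. 3.9 (1) for `P[sideCross] ≥ h_λ(c)`, this is NTW's
(3.19) `f(2n,n-1) ≥ c ⟹ P[𝒜_{λn,2λn}] ≥ c'` up to the corner-gluing inequalities.

## Sources

* C. M. Newman, V. Tassion, W. Wu, *Critical percolation and the minimal spanning tree in slabs*,
  Comm. Pure Appl. Math. 70 (2017) 2084–2120, arXiv:1512.09107: proof of Theorem 3.10,
  (3.74) and (3.121)–(3.122) (pp. 13–14) [NewmanTassionWu2017].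
-/

noncomputable section

namespace Literature.Probability.Percolation

open MeasureTheory LatticeModels
open scoped LatticeModels

namespace NTW17

variable {k : ℕ}

/-! ## The stages of the chain -/

section Stages

variable (k) (N n : ℕ)

/-- The four hub uniqueness events together. [cite: NewmanTassionWu2017, Theorem 3.10 (proof, ℰ = ℰ₀ ∩ 𝒰₁ ∩ 𝒰₂)] -/
def hubUniq4 : Set (BondConfig (slab 3 k)) := hubUniqT k N n ∩ hubUniqR k N n ∩ hubUniqB k N n ∩ hubUniqL k N n

/-- The starting event `ℰ = ℰ₀ ∩ 𝒰⁴`. [cite: NewmanTassionWu2017, Theorem 3.10 (proof, the event ℰ)] -/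
def stage₀ : Set (BondConfig (slab 3 k)) :=
  sideCrossT k N n ∩ sideCrossR k N n ∩ sideCrossB k N n ∩ sideCrossL k N n ∩ hubUniq4 k N n

/-- Bystander of the top-right gluing: what the later corners need and the hub uniqueness.
[cite: NewmanTassionWu2017, Theorem 3.10 (proof, (3.121))] -/
def byst₁ : Set (BondConfig (slab 3 k)) :=
  slabConn k (domR N n) {z | z.2 = (N : ℤ)} {z | z.2 = -((N : ℤ) + n + 1)} ∩
    slabConn k (corT N n) {z | z.1 = (N : ℤ)} {z | z.1 = -((N : ℤ) + n)} ∩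
    sideCrossB k N n ∩ sideCrossL k N n ∩ hubUniq4 k N n

/-- Stage 1: the top-right corner link with its bystander. [cite: NewmanTassionWu2017, Theorem 3.10 (proof, (3.121))] -/
def stage₁ : Set (BondConfig (slab 3 k)) := cornerLink₁ k N n ∩ byst₁ k N n

/-- Bystander of the bottom-right gluing. [cite: NewmanTassionWu2017, Theorem 3.10 (proof, (3.122))] -/
def byst₂ : Set (BondConfig (slab 3 k)) :=
  cornerLink₁ k N n ∩ slabConn k (domB N n) {z | z.1 = (N : ℤ)} {z | z.1 = -((N : ℤ) + n + 1)} ∩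
    slabConn k (corT N n) {z | z.1 = (N : ℤ)} {z | z.1 = -((N : ℤ) + n)} ∩
    sideCrossL k N n ∩ hubUniq4 k N n

/-- Stage 2. [cite: NewmanTassionWu2017, Theorem 3.10 (proof, (3.122))] -/
def stage₂ : Set (BondConfig (slab 3 k)) := cornerLink₂ k N n ∩ byst₂ k N n

/-- Bystander of the bottom-left gluing. [cite: NewmanTassionWu2017, Theorem 3.10 (proof, (3.122))] -/
def byst₃ : Set (BondConfig (slab 3 k)) :=
  cornerLink₁ k N n ∩ cornerLink₂ k N n ∩
    slabConn k (domL N n) {z | z.2 = -(N : ℤ)} {z | z.2 = (N : ℤ) + n + 1} ∩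
    slabConn k (corT N n) {z | z.1 = (N : ℤ)} {z | z.1 = -((N : ℤ) + n)} ∩ hubUniq4 k N n

/-- Stage 3. [cite: NewmanTassionWu2017, Theorem 3.10 (proof, (3.122))] -/
def stage₃ : Set (BondConfig (slab 3 k)) := cornerLink₃ k N n ∩ byst₃ k N n

/-- Bystander of the top-left gluing: the three earlier links and the hub uniqueness.
[cite: NewmanTassionWu2017, Theorem 3.10 (proof, (3.122))] -/
def byst₄ : Set (BondConfig (slab 3 k)) :=
  cornerLink₁ k N n ∩ cornerLink₂ k N n ∩ cornerLink₃ k N n ∩ hubUniq4 k N n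

/-- Stage 4: all four corner links and the hub uniqueness — a surrounding circuit
(`circuitAround_of_cornerLinks`). [cite: NewmanTassionWu2017, Theorem 3.10 (proof, (3.122))] -/
def stage₄ : Set (BondConfig (slab 3 k)) := cornerLink₄ k N n ∩ byst₄ k N n

end Stages

/-! ## Each stage feeds the next gluing -/

section Mono

variable {N n : ℕ} {ω : BondConfig (slab 3 k)}

/-- Stage 0 lies in the top-right corner's domain event with its bystander, or already in stage 1.
[cite: NewmanTassionWu2017, Theorem 3.10 (proof, (3.121))] -/
theorem stage₀_subset (hN : 2 ≤ N) (hω : ω ⊆ (slabGraph 3 k).edgeSet) (h : ω ∈ stage₀ k N n) :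
    ω ∈ (byst₁ k N n ∩ cornerDom₁ k N n ∩ (cornerLink₁ k N n)ᶜ) ∪ stage₁ k N n := by
  obtain ⟨⟨⟨⟨hT, hR⟩, hB⟩, hL⟩, hU⟩ := h
  have hN1 : 1 ≤ N := by omega
  have hb : ω ∈ byst₁ k N n :=
    ⟨⟨⟨⟨domR_cross_of_sideCrossR hω hR, corT_cross_of_sideCrossT hN1 hω hT⟩, hB⟩, hL⟩, hU⟩
  by_cases hl : ω ∈ cornerLink₁ k N n
  · exact Or.inr ⟨hl, hb⟩
  · exact Or.inl ⟨⟨hb, domT_cross_of_sideCrossT hω hT, corR_cross_of_sideCrossR hN1 hω hR⟩, hl⟩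

/-- Stage 1 feeds the bottom-right gluing. [cite: NewmanTassionWu2017, Theorem 3.10 (proof, (3.122))] -/
theorem stage₁_subset (hN : 2 ≤ N) (hω : ω ⊆ (slabGraph 3 k).edgeSet) (h : ω ∈ stage₁ k N n) :
    ω ∈ (byst₂ k N n ∩ cornerDom₂ k N n ∩ (cornerLink₂ k N n)ᶜ) ∪ stage₂ k N n := by
  obtain ⟨hl₁, ⟨⟨⟨⟨hdR, hcT⟩, hB⟩, hL⟩, hU⟩⟩ := h
  have hN1 : 1 ≤ N := by omega
  have hb : ω ∈ byst₂ k N n := ⟨⟨⟨⟨hl₁, domB_cross_of_sideCrossB hω hB⟩, hcT⟩, hL⟩, hU⟩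
  by_cases hl : ω ∈ cornerLink₂ k N n
  · exact Or.inr ⟨hl, hb⟩
  · exact Or.inl ⟨⟨hb, hdR, corB_cross_of_sideCrossB hN1 hω hB⟩, hl⟩

/-- Stage 2 feeds the bottom-left gluing. [cite: NewmanTassionWu2017, Theorem 3.10 (proof, (3.122))] -/
theorem stage₂_subset (hN : 2 ≤ N) (hω : ω ⊆ (slabGraph 3 k).edgeSet) (h : ω ∈ stage₂ k N n) :
    ω ∈ (byst₃ k N n ∩ cornerDom₃ k N n ∩ (cornerLink₃ k N n)ᶜ) ∪ stage₃ k N n := by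
  obtain ⟨hl₂, ⟨⟨⟨⟨hl₁, hdB⟩, hcT⟩, hL⟩, hU⟩⟩ := h
  have hN1 : 1 ≤ N := by omega
  have hb : ω ∈ byst₃ k N n := ⟨⟨⟨⟨hl₁, hl₂⟩, domL_cross_of_sideCrossL hω hL⟩, hcT⟩, hU⟩
  by_cases hl : ω ∈ cornerLink₃ k N n
  · exact Or.inr ⟨hl, hb⟩
  · exact Or.inl ⟨⟨hb, hdB, corL_cross_of_sideCrossL hN1 hω hL⟩, hl⟩

/-- Stage 3 feeds the top-left gluing. [cite: NewmanTassionWu2017, Theorem 3.10 (proof, (3.122))] -/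
theorem stage₃_subset (h : ω ∈ stage₃ k N n) :
    ω ∈ (byst₄ k N n ∩ cornerDom₄ k N n ∩ (cornerLink₄ k N n)ᶜ) ∪ stage₄ k N n := by
  obtain ⟨hl₃, ⟨⟨⟨⟨hl₁, hl₂⟩, hdL⟩, hcT⟩, hU⟩⟩ := h
  have hb : ω ∈ byst₄ k N n := ⟨⟨⟨hl₁, hl₂⟩, hl₃⟩, hU⟩
  by_cases hl : ω ∈ cornerLink₄ k N n
  · exact Or.inr ⟨hl, hb⟩
  · exact Or.inl ⟨⟨hb, hdL, hcT⟩, hl⟩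

/-- Stage 4 is a surrounding circuit. [cite: NewmanTassionWu2017, Theorem 3.10 (proof, "Thus ω^{(z)} ∈ 𝒜")] -/
theorem circuitAround_of_stage₄ (hN : 2 ≤ N) (hω : ω ⊆ (slabGraph 3 k).edgeSet) (h : ω ∈ stage₄ k N n) :
    ω ∈ circuitAround k (0, 0) N (N + n + 1) := by
  obtain ⟨hl₄, ⟨⟨⟨hl₁, hl₂⟩, hl₃⟩, ⟨⟨⟨uT, uR⟩, uB⟩, uL⟩⟩⟩ := h
  exact circuitAround_of_cornerLinks hN hω hl₁ hl₂ hl₃ hl₄ uT uR uB uL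

end Mono

/-! ## Locality of the bystanders -/

section Locality

variable {N n : ℕ}

/-- Rectangles are finite. [folklore] -/
private theorem boxR_fin (a b c d : ℤ) : (boxR a b c d).Finite := by
  refine ((Set.finite_Icc a b).prod (Set.finite_Icc c d)).subset fun z hz => ?_
  simp only [mem_boxR_iff] at hz
  exact ⟨⟨hz.1, hz.2.1⟩, ⟨hz.2.2.1, hz.2.2.2⟩⟩

/-- Crossing events of finite regions are measurable. [folklore] -/
private theorem meas_conn {B : Set (ℤ × ℤ)} (hB : B.Finite) (X Y : Set (ℤ × ℤ)) :
    MeasurableSet (slabConn k B X Y) := measurableSet_slabConn_of_finite k hB X Y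

/-- The hub uniqueness events are measurable. [folklore] -/
private theorem meas_hubUniq4 : MeasurableSet (hubUniq4 k N n) :=
  (((measurableSet_linked_boxR _ _ _ _ _ _).inter (measurableSet_linked_boxR _ _ _ _ _ _)).inter
    (measurableSet_linked_boxR _ _ _ _ _ _)).inter (measurableSet_linked_boxR _ _ _ _ _ _)

/-- The hub uniqueness events are determined by the edges inside the lift of any planar set containing
the four hub strips. [folklore] -/
private theorem det_hubUniq4 {T : Set (ℤ × ℤ)} (hT : hubT N n ⊆ T) (hR : hubR N n ⊆ T) (hB : hubB N n ⊆ T)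
    (hL : hubL N n ⊆ T) : DeterminedBy (hubUniq4 k N n) (Set.sym2 (slabLift k T)) :=
  (((determinedBy_linked _ _ hT).inter (determinedBy_linked _ _ hR)).inter (determinedBy_linked _ _ hB)).inter
    (determinedBy_linked _ _ hL)

/-- The region carrying the first bystander. [folklore] -/
private def Ω₁ (N n : ℕ) : Set (ℤ × ℤ) :=
  domR N n ∪ corT N n ∪ ringSideB N n ∪ ringSideL N n ∪ (hubT N n ∪ hubR N n ∪ hubB N n ∪ hubL N n)

/-- The region carrying the second bystander. [folklore] -/
private def Ω₂ (N n : ℕ) : Set (ℤ × ℤ) :=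
  (domT N n ∪ corR N n) ∪ domB N n ∪ corT N n ∪ ringSideL N n ∪ (hubT N n ∪ hubR N n ∪ hubB N n ∪ hubL N n)

/-- The region carrying the third bystander. [folklore] -/
private def Ω₃ (N n : ℕ) : Set (ℤ × ℤ) :=
  (domT N n ∪ corR N n) ∪ (domR N n ∪ corB N n) ∪ domL N n ∪ corT N n ∪ (hubT N n ∪ hubR N n ∪ hubB N n ∪ hubL N n)

/-- The region carrying the fourth bystander. [folklore] -/
private def Ω₄ (N n : ℕ) : Set (ℤ × ℤ) :=
  (domT N n ∪ corR N n) ∪ (domR N n ∪ corB N n) ∪ (domB N n ∪ corL N n) ∪ (hubT N n ∪ hubR N n ∪ hubB N n ∪ hubL N n)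

/-- The bystander regions avoid the corresponding corner squares (`N ≥ 2`). [folklore] -/
private theorem Ω_disjoint (hN : 2 ≤ N) :
    Disjoint (Ω₁ N n) (cornerSq N n 0) ∧ Disjoint (Ω₂ N n) (cornerSq N n 1) ∧
      Disjoint (Ω₃ N n) (cornerSq N n 2) ∧ Disjoint (Ω₄ N n) (cornerSq N n 3) := by
  refine ⟨?_, ?_, ?_, ?_⟩ <;> refine Set.disjoint_left.2 fun z hz hz' => ?_ <;>
    simp only [Ω₁, Ω₂, Ω₃, Ω₄, cornerSq, domT, corR, domR, corB, domB, corL, domL, corT, ringSideB, ringSideL,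
      hubT, hubR, hubB, hubL, Set.mem_union, mem_boxR_iff, Fin.isValue, if_true, Fin.reduceEq, if_false] at hz hz' <;>
    omega

/-- Locality and measurability of the four bystanders. [folklore] -/
private theorem byst_local :
    (DeterminedBy (byst₁ k N n) (Set.sym2 (slabLift k (Ω₁ N n))) ∧ MeasurableSet (byst₁ k N n)) ∧
      (DeterminedBy (byst₂ k N n) (Set.sym2 (slabLift k (Ω₂ N n))) ∧ MeasurableSet (byst₂ k N n)) ∧
      (DeterminedBy (byst₃ k N n) (Set.sym2 (slabLift k (Ω₃ N n))) ∧ MeasurableSet (byst₃ k N n)) ∧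
      (DeterminedBy (byst₄ k N n) (Set.sym2 (slabLift k (Ω₄ N n))) ∧ MeasurableSet (byst₄ k N n)) := by
  have d : ∀ {B T : Set (ℤ × ℤ)} (X Y : Set (ℤ × ℤ)), B ⊆ T → DeterminedBy (slabConn k B X Y) (Set.sym2 (slabLift k T)) :=
    fun X Y h => determinedBy_slabConn k X Y h
  have fU : ∀ a b c d a' b' c' d' : ℤ, (boxR a b c d ∪ boxR a' b' c' d').Finite :=
    fun _ _ _ _ _ _ _ _ => (boxR_fin _ _ _ _).union (boxR_fin _ _ _ _)
  have sub : ∀ {A T : Set (ℤ × ℤ)}, (∀ z, z ∈ A → z ∈ T) → A ⊆ T := fun h => h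
  refine ⟨⟨?_, ?_⟩, ⟨?_, ?_⟩, ⟨?_, ?_⟩, ⟨?_, ?_⟩⟩
  · refine ((((d _ _ ?_).inter (d _ _ ?_)).inter (d _ _ ?_)).inter (d _ _ ?_)).inter (det_hubUniq4 ?_ ?_ ?_ ?_) <;>
      intro z hz <;> simp only [Ω₁, Set.mem_union] at hz ⊢ <;> tauto
  · exact ((((meas_conn (boxR_fin _ _ _ _) _ _).inter (meas_conn (boxR_fin _ _ _ _) _ _)).inter
      (meas_conn (boxR_fin _ _ _ _) _ _)).inter (meas_conn (boxR_fin _ _ _ _) _ _)).inter meas_hubUniq4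
  · refine ((((d _ _ ?_).inter (d _ _ ?_)).inter (d _ _ ?_)).inter (d _ _ ?_)).inter (det_hubUniq4 ?_ ?_ ?_ ?_) <;>
      intro z hz <;> simp only [Ω₂, Set.mem_union] at hz ⊢ <;> tauto
  · exact ((((meas_conn (fU _ _ _ _ _ _ _ _) _ _).inter (meas_conn (boxR_fin _ _ _ _) _ _)).inter
      (meas_conn (boxR_fin _ _ _ _) _ _)).inter (meas_conn (boxR_fin _ _ _ _) _ _)).inter meas_hubUniq4
  · refine ((((d _ _ ?_).inter (d _ _ ?_)).inter (d _ _ ?_)).inter (d _ _ ?_)).inter (det_hubUniq4 ?_ ?_ ?_ ?_) <;>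
      intro z hz <;> simp only [Ω₃, Set.mem_union] at hz ⊢ <;> tauto
  · exact ((((meas_conn (fU _ _ _ _ _ _ _ _) _ _).inter (meas_conn (fU _ _ _ _ _ _ _ _) _ _)).inter
      (meas_conn (boxR_fin _ _ _ _) _ _)).inter (meas_conn (boxR_fin _ _ _ _) _ _)).inter meas_hubUniq4
  · refine (((d _ _ ?_).inter (d _ _ ?_)).inter (d _ _ ?_)).inter (det_hubUniq4 ?_ ?_ ?_ ?_) <;>
      intro z hz <;> simp only [Ω₄, Set.mem_union] at hz ⊢ <;> tauto
  · exact (((meas_conn (fU _ _ _ _ _ _ _ _) _ _).inter (meas_conn (fU _ _ _ _ _ _ _ _) _ _)).inter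
      (meas_conn (fU _ _ _ _ _ _ _ _) _ _)).inter meas_hubUniq4

end Locality

/-! ## The chain -/

section Chain

variable {N n : ℕ}

/-- One link of the chain: if the current stage lies (almost surely) in the next corner's domain event
with bystander `G` off the next link, or in the next stage `G ∩ link`, and the corner-gluing
inequality holds for `G`, then `P[stage] ≤ (1+K) P[next stage]`.
[cite: NewmanTassionWu2017, Theorem 3.10 (proof, (3.121)–(3.122) with Lemma 3.5)] -/
theorem real_stage_le (p : unitInterval) {K : ℝ} {S G D L : Set (BondConfig (slab 3 k))}
    (hsub : ∀ ω, ω ⊆ (slabGraph 3 k).edgeSet → ω ∈ S → ω ∈ (G ∩ D ∩ Lᶜ) ∪ (L ∩ G))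
    (hglue : (bondPercolation (slabGraph 3 k) p).real (G ∩ D ∩ Lᶜ) ≤ K * (bondPercolation (slabGraph 3 k) p).real (G ∩ L)) :
    (bondPercolation (slabGraph 3 k) p).real S ≤ (1 + K) * (bondPercolation (slabGraph 3 k) p).real (L ∩ G) := by
  set P := bondPercolation (slabGraph 3 k) p
  have hae : ∀ᵐ ω ∂P, ω ∈ S → ω ∈ (G ∩ D ∩ Lᶜ) ∪ (L ∩ G) := by
    filter_upwards [ae_subset_edgeSet (slabGraph 3 k) p] with ω hω using hsub ω hω
  have h1 : P.real S ≤ P.real ((G ∩ D ∩ Lᶜ) ∪ (L ∩ G)) := by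
    simp only [measureReal_def]
    exact ENNReal.toReal_mono (measure_ne_top _ _) (measure_mono_ae hae)
  have hGL : G ∩ L = L ∩ G := Set.inter_comm _ _
  calc P.real S ≤ P.real ((G ∩ D ∩ Lᶜ) ∪ (L ∩ G)) := h1
    _ ≤ P.real (G ∩ D ∩ Lᶜ) + P.real (L ∩ G) := measureReal_union_le _ _
    _ ≤ K * P.real (G ∩ L) + P.real (L ∩ G) := by gcongr
    _ = (1 + K) * P.real (L ∩ G) := by rw [hGL]; ring

/-- **NTW Theorem 3.10 modulo the corner-gluing inequalities.**  For `N ≥ 2`, `K ≥ 0`, and a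
parameter `p`: if the four corner-gluing inequalities `CornerGlue₁..₄ k N n p K` hold, and for the
four sides `P[hubCross_X]² ≤ δ · P[sideCross_X]` with `0 ≤ δ`, `4δ ≤ 1/2`, then
`½ · P[sideCrossT] P[sideCrossR] P[sideCrossB] P[sideCrossL] ≤ (1+K)⁴ · P[circuitAround k 0 N (N+n+1)]`.
[cite: NewmanTassionWu2017, Theorem 3.10 (proof, (3.74) and (3.121)–(3.122))] -/
theorem real_circuitAround_ge_of_cornerGlue (hN : 2 ≤ N) (p : unitInterval) {K : ℝ} (hK : 0 ≤ K)
    (hG₁ : CornerGlue₁ k N n p K) (hG₂ : CornerGlue₂ k N n p K) (hG₃ : CornerGlue₃ k N n p K)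
    (hG₄ : CornerGlue₄ k N n p K) {δ : ℝ} (hδ0 : 0 ≤ δ) (hδ : 4 * δ ≤ 1 / 2)
    (hT : (bondPercolation (slabGraph 3 k) p).real (hubCrossT k N n) ^ 2 ≤ δ * (bondPercolation (slabGraph 3 k) p).real (sideCrossT k N n))
    (hR : (bondPercolation (slabGraph 3 k) p).real (hubCrossR k N n) ^ 2 ≤ δ * (bondPercolation (slabGraph 3 k) p).real (sideCrossR k N n))
    (hB : (bondPercolation (slabGraph 3 k) p).real (hubCrossB k N n) ^ 2 ≤ δ * (bondPercolation (slabGraph 3 k) p).real (sideCrossB k N n))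
    (hL : (bondPercolation (slabGraph 3 k) p).real (hubCrossL k N n) ^ 2 ≤ δ * (bondPercolation (slabGraph 3 k) p).real (sideCrossL k N n)) :
    (1 / 2 : ℝ) * ((bondPercolation (slabGraph 3 k) p).real (sideCrossT k N n) *
        (bondPercolation (slabGraph 3 k) p).real (sideCrossR k N n) *
        (bondPercolation (slabGraph 3 k) p).real (sideCrossB k N n) *
        (bondPercolation (slabGraph 3 k) p).real (sideCrossL k N n)) ≤
      (1 + K) ^ 4 * (bondPercolation (slabGraph 3 k) p).real (circuitAround k (0, 0) N (N + n + 1)) := by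
  set P := bondPercolation (slabGraph 3 k) p with hP
  obtain ⟨⟨b1d, b1m⟩, ⟨b2d, b2m⟩, ⟨b3d, b3m⟩, ⟨b4d, b4m⟩⟩ := (byst_local : (DeterminedBy (byst₁ k N n) _ ∧ _) ∧ _)
  obtain ⟨o1, o2, o3, o4⟩ := Ω_disjoint (n := n) hN
  -- the four links of the chain
  have s0 : P.real (stage₀ k N n) ≤ (1 + K) * P.real (stage₁ k N n) :=
    real_stage_le p (fun ω hω h => stage₀_subset hN hω h) (hG₁ _ _ o1 b1d b1m)
  have s1 : P.real (stage₁ k N n) ≤ (1 + K) * P.real (stage₂ k N n) :=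
    real_stage_le p (fun ω hω h => stage₁_subset hN hω h) (hG₂ _ _ o2 b2d b2m)
  have s2 : P.real (stage₂ k N n) ≤ (1 + K) * P.real (stage₃ k N n) :=
    real_stage_le p (fun ω hω h => stage₂_subset hN hω h) (hG₃ _ _ o3 b3d b3m)
  have s3 : P.real (stage₃ k N n) ≤ (1 + K) * P.real (stage₄ k N n) :=
    real_stage_le p (fun ω _ h => stage₃_subset h) (hG₄ _ _ o4 b4d b4m)
  -- the last stage is a circuit, almost surely
  have s4 : P.real (stage₄ k N n) ≤ P.real (circuitAround k (0, 0) N (N + n + 1)) := by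
    have hae : ∀ᵐ ω ∂P, ω ∈ stage₄ k N n → ω ∈ circuitAround k (0, 0) N (N + n + 1) := by
      filter_upwards [ae_subset_edgeSet (slabGraph 3 k) p] with ω hω using circuitAround_of_stage₄ hN hω
    simp only [measureReal_def]
    exact ENNReal.toReal_mono (measure_ne_top _ _) (measure_mono_ae hae)
  -- the starting event
  have start := real_sideCross_inter_hubUniq_ge (k := k) (n := n) hN p hδ0 hδ hT hR hB hL
  have hstage₀ : sideCrossT k N n ∩ sideCrossR k N n ∩ sideCrossB k N n ∩ sideCrossL k N n ∩
      (hubUniqT k N n ∩ hubUniqR k N n ∩ hubUniqB k N n ∩ hubUniqL k N n) = stage₀ k N n := rfl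
  rw [hstage₀] at start
  have h1K : 0 ≤ 1 + K := by linarith
  calc (1 / 2 : ℝ) * (P.real (sideCrossT k N n) * P.real (sideCrossR k N n) * P.real (sideCrossB k N n) *
        P.real (sideCrossL k N n)) ≤ P.real (stage₀ k N n) := start
    _ ≤ (1 + K) * P.real (stage₁ k N n) := s0
    _ ≤ (1 + K) * ((1 + K) * P.real (stage₂ k N n)) := by gcongr
    _ ≤ (1 + K) * ((1 + K) * ((1 + K) * P.real (stage₃ k N n))) := by gcongr
    _ ≤ (1 + K) * ((1 + K) * ((1 + K) * ((1 + K) * P.real (stage₄ k N n)))) := by gcongr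
    _ ≤ (1 + K) * ((1 + K) * ((1 + K) * ((1 + K) * P.real (circuitAround k (0, 0) N (N + n + 1))))) := by gcongr
    _ = (1 + K) ^ 4 * P.real (circuitAround k (0, 0) N (N + n + 1)) := by ring

end Chain

end NTW17

end Literature.Probability.Percolation

end
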